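import Mathlib
import HarnessLib
import Summits.Parity.BatemanHorn.Theorems.IsogenyRedeiSplitBlockJacobiCornerMbbSupport
import Summits.Parity.BatemanHorn.Theorems.IsogenyRedeiSplitBlockJacobiCornerMbbPieceI

/-!
# Support lemmas for `stub_mbb_of_boxInputs` (line `Sketch`, crux `SplitBlockJacobiCorner`,
# stmt-Parity-15002): from the twisted prime sum to the `Λ ⊗ Λ` bilinear form

* `abel_step` — removing the weights `1/(log Q · log Q')` by the landed 2D Abel bound: for
  `P₁, P₂ ≥ 3`, `‖twistedSum h P₁ P₁' P₂ P₂'‖ ≤ B` as soon as every anchored box sum of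
  `[Q prime ≡ 1] log Q · [Q' prime ≡ 1] log Q' · (Q|Q') S(h,QQ')` has norm `≤ B`;
* `card_primePow_not_prime_le` — at most `√t · log₂ t` non-prime prime powers `≤ t`;
* `norm_primeLog_sub_vonMangoldt_bilinear_le` — replacing `[prime] log` by `Λ` in both variables
  costs `≤ D² L² (√t log₂ t · t' + t · √t' log₂ t')` (`τ ≤ D`, `log ≤ L` on the ranges).
-/

noncomputable section

open Finset ArithmeticFunction

namespace Summit.Parity.BatemanHorn.Cruxes.SplitBlockJacobiCorner.Sketch.MbbOfBoxInputs

open Summit.Parity.BatemanHorn.Cruxes.SplitBlockJacobi.CofactorRootDiscrepancy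

/-! ### Abel: removing `1/(log Q log Q')` -/

/-- **Abel step.** For `3 ≤ P₁ ≤ P₁'`, `3 ≤ P₂ ≤ P₂'`: if every anchored box sum
`Σ_{Q ∈ (P₁,m]} Σ_{Q' ∈ (P₂,n]} [Q prime ≡ 1 (4)] log Q · [Q' prime ≡ 1 (4)] log Q' · (Q|Q') S(h, QQ')`
has norm `≤ B`, then `‖twistedSum h P₁ P₁' P₂ P₂'‖ ≤ B` (the weight `1/(log Q log Q')` is a tensor
of non-increasing weights `≤ 1`). [folklore] -/
theorem abel_step (h : ℤ) {P₁ P₁' P₂ P₂' : ℕ} (hP₁ : 3 ≤ P₁) (h₁ : P₁ ≤ P₁') (hP₂ : 3 ≤ P₂)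
    (h₂ : P₂ ≤ P₂') {B : ℝ}
    (hB : ∀ m ∈ Icc P₁ P₁', ∀ n ∈ Icc P₂ P₂',
      ‖∑ Q ∈ Ioc P₁ m, ∑ Q' ∈ Ioc P₂ n,
        (if Q.Prime ∧ Q % 4 = 1 then ((Real.log Q : ℝ) : ℂ) else 0) *
          (if Q'.Prime ∧ Q' % 4 = 1 then ((Real.log Q' : ℝ) : ℂ) else 0) *
          ((jacobiSym (Q : ℤ) Q' : ℂ) * rootWeylSum h (Q * Q'))‖ ≤ B) :
    ‖twistedSum h P₁ P₁' P₂ P₂'‖ ≤ B := by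
  have hB0 : 0 ≤ B := (norm_nonneg _).trans (hB P₁ (Finset.mem_Icc.mpr ⟨le_rfl, h₁⟩) P₂
    (Finset.mem_Icc.mpr ⟨le_rfl, h₂⟩))
  set f : ℕ → ℕ → ℂ := fun Q Q' =>
    (if Q.Prime ∧ Q % 4 = 1 then ((Real.log Q : ℝ) : ℂ) else 0) *
      (if Q'.Prime ∧ Q' % 4 = 1 then ((Real.log Q' : ℝ) : ℂ) else 0) *
      ((jacobiSym (Q : ℤ) Q' : ℂ) * rootWeylSum h (Q * Q')) with hf
  set u : ℕ → ℂ := fun Q => (((1 / Real.log Q : ℝ)) : ℂ) with hu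
  -- the twisted sum as `Σ f · (u ⊗ u)`
  have hlogpos : ∀ Q : ℕ, 3 ≤ Q → 0 < Real.log Q := fun Q hQ =>
    Real.log_pos (by exact_mod_cast (by omega : 1 < Q))
  have hT : twistedSum h P₁ P₁' P₂ P₂' =
      ∑ Q ∈ Ioc P₁ P₁', ∑ Q' ∈ Ioc P₂ P₂', f Q Q' * (u Q * u Q') := by
    unfold twistedSum
    rw [Finset.sum_filter]
    refine Finset.sum_congr rfl fun Q hQ => ?_
    have hQ3 : 3 ≤ Q := by have := (Finset.mem_Ioc.mp hQ).1; omega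
    split_ifs with hQp
    · rw [Finset.sum_filter]
      refine Finset.sum_congr rfl fun Q' hQ' => ?_
      have hQ'3 : 3 ≤ Q' := by have := (Finset.mem_Ioc.mp hQ').1; omega
      split_ifs with hQ'p
      · simp only [hf, hu, hQp, hQ'p, and_self, if_true]
        have e1 : ((Real.log Q : ℝ) : ℂ) * (((1 / Real.log Q : ℝ)) : ℂ) = 1 := by
          rw [← Complex.ofReal_mul, mul_one_div_cancel (hlogpos Q hQ3).ne', Complex.ofReal_one]
        have e2 : ((Real.log Q' : ℝ) : ℂ) * (((1 / Real.log Q' : ℝ)) : ℂ) = 1 := by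
          rw [← Complex.ofReal_mul, mul_one_div_cancel (hlogpos Q' hQ'3).ne', Complex.ofReal_one]
        calc (jacobiSym (Q : ℤ) Q' : ℂ) * rootWeylSum h (Q * Q')
            = (((Real.log Q : ℝ) : ℂ) * (((1 / Real.log Q : ℝ)) : ℂ)) *
                (((Real.log Q' : ℝ) : ℂ) * (((1 / Real.log Q' : ℝ)) : ℂ)) *
                ((jacobiSym (Q : ℤ) Q' : ℂ) * rootWeylSum h (Q * Q')) := by rw [e1, e2]; ring
          _ = _ := by ring
      · simp [hf, hQ'p]
    · symm
      refine Finset.sum_eq_zero fun Q' _ => ?_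
      simp [hf, hQp]
  rw [hT]
  have hmono : ∀ (a a' : ℕ), 3 ≤ a → ∀ m, a ≤ m → m < a' →
      1 / Real.log ((m + 1 : ℕ) : ℝ) ≤ 1 / Real.log (m : ℝ) := by
    intro a a' ha m ham _
    have hm : 0 < Real.log (m : ℝ) := hlogpos m (by omega)
    apply one_div_le_one_div_of_le hm
    exact Real.log_le_log (by exact_mod_cast (by omega : 0 < m)) (by push_cast; linarith)
  have hVu : ‖u P₁'‖ + ∑ m ∈ Ico P₁ P₁', ‖u (m + 1) - u m‖ ≤ 1 := by
    have := antitone_weight_variation (fun Q : ℕ => 1 / Real.log Q) h₁ (hmono P₁ P₁' hP₁)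
      (le_of_lt (one_div_pos.mpr (hlogpos P₁' (by omega))))
    simp only [hu]
    rw [this]
    rw [div_le_one (hlogpos P₁ hP₁)]
    have h3 : Real.log 3 ≤ Real.log (P₁ : ℝ) := Real.log_le_log (by norm_num) (by exact_mod_cast hP₁)
    have : (1 : ℝ) ≤ Real.log 3 := by
      rw [Real.le_log_iff_exp_le (by norm_num)]
      exact le_trans (le_of_lt Real.exp_one_lt_d9) (by norm_num)
    linarith
  have hVv : ‖u P₂'‖ + ∑ n ∈ Ico P₂ P₂', ‖u (n + 1) - u n‖ ≤ 1 := by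
    have := antitone_weight_variation (fun Q : ℕ => 1 / Real.log Q) h₂ (hmono P₂ P₂' hP₂)
      (le_of_lt (one_div_pos.mpr (hlogpos P₂' (by omega))))
    simp only [hu]
    rw [this]
    rw [div_le_one (hlogpos P₂ hP₂)]
    have h3 : Real.log 3 ≤ Real.log (P₂ : ℝ) := Real.log_le_log (by norm_num) (by exact_mod_cast hP₂)
    have : (1 : ℝ) ≤ Real.log 3 := by
      rw [Real.le_log_iff_exp_le (by norm_num)]
      exact le_trans (le_of_lt Real.exp_one_lt_d9) (by norm_num)
    linarith
  have key := weighted_box_bound f u u h₁ h₂ hB hVu hVv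
  calc _ ≤ B * (1 * 1) := key
    _ = B := by ring

/-! ### Prime powers that are not primes -/

/-- At most `√t · log₂ t` non-prime prime powers in `(0, t]` (inject `p^k ↦ (p, k)`, `p ≤ √t`,
`2 ≤ k ≤ log₂ t`). [folklore] -/
theorem card_primePow_not_prime_le (t : ℕ) :
    ((Ioc 0 t).filter (fun Q : ℕ => IsPrimePow Q ∧ ¬ Q.Prime)).card ≤ Nat.sqrt t * Nat.log 2 t := by
  have hmaps : ∀ Q ∈ (Ioc 0 t).filter (fun Q : ℕ => IsPrimePow Q ∧ ¬ Q.Prime),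
      (Q.minFac, Q.factorization Q.minFac) ∈ Icc 1 (Nat.sqrt t) ×ˢ Icc 1 (Nat.log 2 t) := by
    intro Q hQ
    rw [Finset.mem_filter, Finset.mem_Ioc] at hQ
    obtain ⟨⟨hQ0, hQt⟩, hpp, hnp⟩ := hQ
    have hfac := hpp.minFac_pow_factorization_eq
    set p := Q.minFac with hp
    set k := Q.factorization p with hk
    have hpprime : p.Prime := Nat.minFac_prime (fun h1 => by rw [h1] at hpp; exact not_isPrimePow_one hpp)
    have hk2 : 2 ≤ k := by
      by_contra hlt
      interval_cases k
      · rw [pow_zero] at hfac; rw [← hfac] at hpp; exact not_isPrimePow_one hpp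
      · rw [pow_one] at hfac; rw [← hfac] at hnp; exact hnp hpprime
    rw [Finset.mem_product, Finset.mem_Icc, Finset.mem_Icc]
    refine ⟨⟨hpprime.one_le, ?_⟩, ⟨by omega, ?_⟩⟩
    · rw [Nat.le_sqrt]
      calc p * p = p ^ 2 := (sq p).symm
        _ ≤ p ^ k := Nat.pow_le_pow_right hpprime.pos hk2
        _ = Q := hfac
        _ ≤ t := hQt
    · rw [Nat.le_log_iff_pow_le one_lt_two (by omega)]
      calc 2 ^ k ≤ p ^ k := Nat.pow_le_pow_left hpprime.two_le k
        _ = Q := hfac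
        _ ≤ t := hQt
  have hinj : Set.InjOn (fun Q : ℕ => (Q.minFac, Q.factorization Q.minFac))
      ((Ioc 0 t).filter (fun Q : ℕ => IsPrimePow Q ∧ ¬ Q.Prime) : Set ℕ) := by
    intro Q hQ Q' hQ' hQQ'
    rw [Finset.coe_filter, Set.mem_setOf_eq] at hQ hQ'
    simp only [Prod.mk.injEq] at hQQ'
    obtain ⟨e1, e2⟩ := hQQ'
    calc Q = Q.minFac ^ Q.factorization Q.minFac := hQ.2.1.minFac_pow_factorization_eq.symm
      _ = Q'.minFac ^ Q'.factorization Q'.minFac := by rw [e2, e1]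
      _ = Q' := hQ'.2.1.minFac_pow_factorization_eq
  calc _ ≤ (Icc 1 (Nat.sqrt t) ×ˢ Icc 1 (Nat.log 2 t)).card :=
        Finset.card_le_card_of_injOn _ hmaps hinj
    _ = Nat.sqrt t * Nat.log 2 t := by
        rw [Finset.card_product, Nat.card_Icc, Nat.card_Icc]
        simp

/-! ### Replacing `[prime] log` by `Λ` -/

/-- `0 ≤ Λ(Q) − [Q prime] log Q ≤ [Q a non-prime prime power] log Q`. [folklore] -/
theorem vonMangoldt_sub_primeLog (Q : ℕ) :
    0 ≤ Λ Q - (if Q.Prime then Real.log Q else 0) ∧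
      Λ Q - (if Q.Prime then Real.log Q else 0) ≤
        if IsPrimePow Q ∧ ¬ Q.Prime then Real.log Q else 0 := by
  by_cases hp : Q.Prime
  · rw [if_pos hp, vonMangoldt_apply_prime hp, sub_self, if_neg (fun h => h.2 hp)]
    exact ⟨le_rfl, le_rfl⟩
  · rw [if_neg hp, sub_zero]
    by_cases hpp : IsPrimePow Q
    · rw [if_pos ⟨hpp, hp⟩]
      exact ⟨vonMangoldt_nonneg, vonMangoldt_le_log⟩
    · rw [if_neg (fun h => hpp h.1), vonMangoldt_eq_zero_iff.mpr hpp]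
      exact ⟨le_rfl, le_rfl⟩

/-- **Replacing `[prime] log` by `Λ` in both variables** of the bilinear form with kernel
`(Q|Q') S(h, QQ')` (`‖kernel‖ ≤ τ(Q)τ(Q') ≤ D²`): the difference is at most
`D² L² (√t log₂ t · t' + t · √t' log₂ t')`, from the `≤ √t log₂ t` non-prime prime powers.
[folklore] -/
theorem norm_primeLog_sub_vonMangoldt_bilinear_le (h : ℤ) (P₁ t P₂ t' : ℕ) {D L : ℝ}
    (hD0 : 0 ≤ D) (hL0 : 0 ≤ L)
    (hD1 : ∀ Q ∈ Ioc P₁ t, (Q.divisors.card : ℝ) ≤ D) (hD2 : ∀ Q' ∈ Ioc P₂ t', (Q'.divisors.card : ℝ) ≤ D)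
    (hL1 : ∀ Q ∈ Ioc P₁ t, Real.log Q ≤ L) (hL2 : ∀ Q' ∈ Ioc P₂ t', Real.log Q' ≤ L) :
    ‖∑ Q ∈ (Ioc P₁ t).filter (fun Q : ℕ => Q % 4 = 1),
        ∑ Q' ∈ (Ioc P₂ t').filter (fun Q' : ℕ => Q' % 4 = 1),
          ((((if Q.Prime then Real.log Q else 0) * (if Q'.Prime then Real.log Q' else 0) : ℝ)) -
              (Λ Q * Λ Q' : ℝ) : ℂ) * ((jacobiSym (Q : ℤ) Q' : ℂ) * rootWeylSum h (Q * Q'))‖ ≤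
      D ^ 2 * L ^ 2 * ((Nat.sqrt t * Nat.log 2 t : ℕ) * t' + t * (Nat.sqrt t' * Nat.log 2 t' : ℕ)) := by
  set pl : ℕ → ℝ := fun Q => if Q.Prime then Real.log Q else 0 with hpl
  set E : ℕ → ℝ := fun Q => Λ Q - pl Q with hE
  set e : ℕ → ℝ := fun Q => if IsPrimePow Q ∧ ¬ Q.Prime then Real.log Q else 0 with he
  have hE0 : ∀ Q, 0 ≤ E Q := fun Q => (vonMangoldt_sub_primeLog Q).1
  have hEe : ∀ Q, E Q ≤ e Q := fun Q => (vonMangoldt_sub_primeLog Q).2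
  have hpl0 : ∀ Q, 0 ≤ pl Q := fun Q => by
    simp only [hpl]; split_ifs <;> [exact Real.log_natCast_nonneg Q; exact le_rfl]
  have hplL : ∀ Q, pl Q ≤ Real.log Q := fun Q => by
    simp only [hpl]; split_ifs <;> [exact le_rfl; exact Real.log_natCast_nonneg Q]
  -- pointwise: |pl pl' − Λ Λ'| ≤ E·Λ' + pl·E' ≤ e Q · log Q' + log Q · e Q'
  have hpt : ∀ Q Q' : ℕ, |pl Q * pl Q' - Λ Q * Λ Q'| ≤ e Q * Real.log Q' + Real.log Q * e Q' := by
    intro Q Q'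
    have h1 : pl Q * pl Q' - Λ Q * Λ Q' = -(E Q * Λ Q' + pl Q * E Q') := by
      simp only [hE]; ring
    rw [h1, abs_neg, abs_of_nonneg (add_nonneg (mul_nonneg (hE0 Q) vonMangoldt_nonneg)
      (mul_nonneg (hpl0 Q) (hE0 Q')))]
    exact add_le_add (mul_le_mul (hEe Q) vonMangoldt_le_log vonMangoldt_nonneg
      ((hE0 Q).trans (hEe Q))) (mul_le_mul (hplL Q) (hEe Q') (hE0 Q') (Real.log_natCast_nonneg Q))
  -- sums of `e`
  have hesum : ∀ (P s : ℕ), (∀ Q ∈ Ioc P s, Real.log Q ≤ L) →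
      ∑ Q ∈ (Ioc P s).filter (fun Q : ℕ => Q % 4 = 1), e Q ≤ L * (Nat.sqrt s * Nat.log 2 s : ℕ) := by
    intro P s hLs
    calc ∑ Q ∈ (Ioc P s).filter (fun Q : ℕ => Q % 4 = 1), e Q ≤ ∑ Q ∈ Ioc P s, e Q := by
          apply Finset.sum_le_sum_of_subset_of_nonneg (Finset.filter_subset _ _)
          intro Q _ _; simp only [he]; split_ifs <;> [exact Real.log_natCast_nonneg Q; exact le_rfl]
      _ = ∑ Q ∈ (Ioc P s).filter (fun Q : ℕ => IsPrimePow Q ∧ ¬ Q.Prime), Real.log Q := by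
          rw [Finset.sum_filter]
      _ ≤ ∑ Q ∈ (Ioc P s).filter (fun Q : ℕ => IsPrimePow Q ∧ ¬ Q.Prime), L :=
          Finset.sum_le_sum fun Q hQ => hLs Q (Finset.mem_filter.mp hQ).1
      _ = (((Ioc P s).filter (fun Q : ℕ => IsPrimePow Q ∧ ¬ Q.Prime)).card : ℝ) * L := by
          rw [Finset.sum_const, nsmul_eq_mul]
      _ ≤ (((Ioc 0 s).filter (fun Q : ℕ => IsPrimePow Q ∧ ¬ Q.Prime)).card : ℝ) * L := by
          refine mul_le_mul_of_nonneg_right ?_ hL0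
          exact_mod_cast Finset.card_le_card (Finset.filter_subset_filter _
            (fun Q hQ => by rw [Finset.mem_Ioc] at hQ ⊢; omega))
      _ ≤ (Nat.sqrt s * Nat.log 2 s : ℕ) * L := by
          refine mul_le_mul_of_nonneg_right ?_ hL0
          exact_mod_cast card_primePow_not_prime_le s
      _ = L * (Nat.sqrt s * Nat.log 2 s : ℕ) := mul_comm _ _
  -- cardinalities
  have hcard1 : (((Ioc P₁ t).filter (fun Q : ℕ => Q % 4 = 1)).card : ℝ) ≤ t := by
    calc _ ≤ ((Ioc P₁ t).card : ℝ) := by exact_mod_cast Finset.card_filter_le _ _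
      _ ≤ t := by rw [Nat.card_Ioc]; exact_mod_cast Nat.sub_le t P₁
  have hcard2 : (((Ioc P₂ t').filter (fun Q : ℕ => Q % 4 = 1)).card : ℝ) ≤ t' := by
    calc _ ≤ ((Ioc P₂ t').card : ℝ) := by exact_mod_cast Finset.card_filter_le _ _
      _ ≤ t' := by rw [Nat.card_Ioc]; exact_mod_cast Nat.sub_le t' P₂
  -- main estimate
  set S := (Ioc P₁ t).filter (fun Q : ℕ => Q % 4 = 1) with hS
  set S' := (Ioc P₂ t').filter (fun Q' : ℕ => Q' % 4 = 1) with hS'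
  have hmemS : ∀ Q ∈ S, Q ∈ Ioc P₁ t := fun Q hQ => (Finset.mem_filter.mp hQ).1
  have hmemS' : ∀ Q' ∈ S', Q' ∈ Ioc P₂ t' := fun Q' hQ' => (Finset.mem_filter.mp hQ').1
  calc _ ≤ ∑ Q ∈ S, ‖∑ Q' ∈ S', (((pl Q * pl Q' : ℝ)) - (Λ Q * Λ Q' : ℝ) : ℂ) *
          ((jacobiSym (Q : ℤ) Q' : ℂ) * rootWeylSum h (Q * Q'))‖ := norm_sum_le _ _
    _ ≤ ∑ Q ∈ S, ∑ Q' ∈ S', (e Q * Real.log Q' + Real.log Q * e Q') * (D * D) := by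
        refine Finset.sum_le_sum fun Q hQ => (norm_sum_le _ _).trans (Finset.sum_le_sum fun Q' hQ' => ?_)
        rw [norm_mul]
        refine mul_le_mul ?_ ((norm_kernel_le h Q Q').trans (mul_le_mul (hD1 Q (hmemS Q hQ))
          (hD2 Q' (hmemS' Q' hQ')) (Nat.cast_nonneg _) hD0)) (norm_nonneg _) ?_
        · rw [← Complex.ofReal_sub, Complex.norm_real, Real.norm_eq_abs]
          exact hpt Q Q'
        · exact add_nonneg (mul_nonneg ((hE0 Q).trans (hEe Q)) (Real.log_natCast_nonneg _))
            (mul_nonneg (Real.log_natCast_nonneg _) ((hE0 Q').trans (hEe Q')))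
    _ = D ^ 2 * ((∑ Q ∈ S, e Q) * (∑ Q' ∈ S', Real.log Q') +
          (∑ Q ∈ S, Real.log Q) * (∑ Q' ∈ S', e Q')) := by
        rw [Finset.sum_mul_sum, Finset.sum_mul_sum, ← Finset.sum_add_distrib]
        rw [Finset.mul_sum]
        refine Finset.sum_congr rfl fun Q _ => ?_
        rw [← Finset.sum_add_distrib, Finset.mul_sum]
        refine Finset.sum_congr rfl fun Q' _ => ?_
        ring
    _ ≤ D ^ 2 * ((L * (Nat.sqrt t * Nat.log 2 t : ℕ)) * (L * t') + (L * t) * (L * (Nat.sqrt t' * Nat.log 2 t' : ℕ))) := by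
        refine mul_le_mul_of_nonneg_left (add_le_add (mul_le_mul (hesum P₁ t hL1) ?_
          (Finset.sum_nonneg fun _ _ => Real.log_natCast_nonneg _) (by positivity))
          (mul_le_mul ?_ (hesum P₂ t' hL2) (Finset.sum_nonneg fun Q _ => by
            simp only [he]; split_ifs <;> [exact Real.log_natCast_nonneg Q; exact le_rfl])
            (by positivity))) (sq_nonneg D)
        · calc ∑ Q' ∈ S', Real.log Q' ≤ ∑ Q' ∈ S', L := Finset.sum_le_sum fun Q' hQ' => hL2 Q' (hmemS' Q' hQ')
            _ = S'.card * L := by rw [Finset.sum_const, nsmul_eq_mul]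
            _ ≤ t' * L := mul_le_mul_of_nonneg_right hcard2 hL0
            _ = L * t' := mul_comm _ _
        · calc ∑ Q ∈ S, Real.log Q ≤ ∑ Q ∈ S, L := Finset.sum_le_sum fun Q hQ => hL1 Q (hmemS Q hQ)
            _ = S.card * L := by rw [Finset.sum_const, nsmul_eq_mul]
            _ ≤ t * L := mul_le_mul_of_nonneg_right hcard1 hL0
            _ = L * t := mul_comm _ _
    _ = _ := by ring

/-- The anchored box sum of `[Q prime ≡ 1] log Q · [Q' prime ≡ 1] log Q' · K` in FILTERED form:
the congruence conditions become the filters `≡ 1 (mod 4)` of the two ranges. [folklore] -/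
theorem primeLog_bilinear_eq_filter (K : ℕ → ℕ → ℂ) (P₁ t P₂ t' : ℕ) :
    ∑ Q ∈ Ioc P₁ t, ∑ Q' ∈ Ioc P₂ t',
        (if Q.Prime ∧ Q % 4 = 1 then ((Real.log Q : ℝ) : ℂ) else 0) *
          (if Q'.Prime ∧ Q' % 4 = 1 then ((Real.log Q' : ℝ) : ℂ) else 0) * K Q Q' =
      ∑ Q ∈ (Ioc P₁ t).filter (fun Q : ℕ => Q % 4 = 1),
        ∑ Q' ∈ (Ioc P₂ t').filter (fun Q' : ℕ => Q' % 4 = 1),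
          ((((if Q.Prime then Real.log Q else 0) * (if Q'.Prime then Real.log Q' else 0) : ℝ)) : ℂ) *
            K Q Q' := by
  rw [Finset.sum_filter]
  refine Finset.sum_congr rfl fun Q _ => ?_
  rw [Finset.sum_filter]
  by_cases hQ : Q % 4 = 1
  · rw [if_pos hQ]
    refine Finset.sum_congr rfl fun Q' _ => ?_
    by_cases hQ' : Q' % 4 = 1
    · rw [if_pos hQ']
      push_cast
      simp only [hQ, hQ', and_true]
      split_ifs <;> simp
    · rw [if_neg hQ']
      simp [hQ']
  · rw [if_neg hQ]
    refine Finset.sum_eq_zero fun Q' _ => ?_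
    simp [hQ]

end Summit.Parity.BatemanHorn.Cruxes.SplitBlockJacobiCorner.Sketch.MbbOfBoxInputs

namespace Summit.Parity.BatemanHorn.Cruxes.SplitBlockJacobiCorner.Sketch

/-- **Registered stub form** (the count of non-prime prime powers): restated in `∀`-form in the crux-line namespace under
the name registered on stmt-Parity-15002. [folklore] -/
theorem mbbTop_card_primePow :
    ∀ t : ℕ, ((Finset.Ioc 0 t).filter (fun Q : ℕ => IsPrimePow Q ∧ ¬ Q.Prime)).card ≤ Nat.sqrt t * Nat.log 2 t :=
  fun t => MbbOfBoxInputs.card_primePow_not_prime_le t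

end Summit.Parity.BatemanHorn.Cruxes.SplitBlockJacobiCorner.Sketch

end
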